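import Summits.HodgeConjecture.HodgeConjecture.Theses.HeckePrymWeil
import Literature.AlgebraicGeometry.Motives.AbelianVarietyProduct
import Literature.AlgebraicGeometry.Motives.AbelianVarietyProjectiveChart
import Literature.AlgebraicGeometry.Motives.HyperbolicWeilType
import Literature.AlgebraicGeometry.HodgeTheory.HodgeModelExistence
import Literature.NumberTheory.Transcendental.DeRhamTheorem
import HarnessLib.Audit

/-!
# drefute certificates — line `amnesic-secant-sheaves-split-fourteenfolds` of crux
# `HeckePrymWeil.WeilTwelvefoldsSqrtMinus7` (item stmt-HodgeConjecture-1261)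

Refuter `refuter-drefute-stmt-HodgeConjecture-1261-0`, 2026-08-16; companion of
`DrefuteAmnesicSurvived.md` (crux dir).  The statements `S1`, `S4`, `S5`, `S6` below are the
registered statements of `stub_hyperbolicFourteenfolds`, `stub_hodgeTypeExterior`, `stub_descent`,
`stub_hodgeModelFacts` of `Lines/amnesic-secant-sheaves-split-fourteenfolds.lean` (lead's reshape r1,
2026-08-16T03:29Z), copied VERBATIM (a Lines file is not an importable module) into this file's own
namespace as `def`s.  Sorry-free kernel certificates of the drefute verdicts:

* `s1_of_hc14` — **HC(14) ⟹ S1** with EVERY hypothesis on `ψ` and `h` ignored: S1 is irrefutable short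
  of `¬HC` on abelian 14-folds (André: Weil classes are motivated), and each of its `ψ`/`h` hypotheses
  is droppable for TRUTH (mutation) — they only carve the sector the amnesic mechanism can reach.
* `s5_of_hc12` — **HC(12) ⟹ S5** likewise.
* `prodHodgeModel_of_s6` — with S6(a) in hand the product Hodge model that S4 needs is FREE
  (`A.prod B` is an abelian variety, `isSmoothProjective_holds`), so after the reshape S4's residual
  content is `preservesHodgeType_of_nonempty_hodgeModel` + `cupPreservesHodgeType_of_nonempty_hodgeModel`
  bookkeeping, and ALL the weight "GAGA + de Rham + Hodge decomposition" sits in S6.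
* `s4_forces_prodHodgeModel` — conversely, already at `c = w = 0`, `k = l = 0` the conclusion of S4
  is EXACTLY a Hodge model of `A × B` (what the pre-reshape S4 silently contained).
-/

noncomputable section

set_option linter.dupNamespace false

open CategoryTheory Complex
open Literature.AlgebraicGeometry Literature.AlgebraicGeometry.Motives
  Literature.AlgebraicGeometry.HodgeTheory Literature.AlgebraicTopology.SingularHomology

namespace Summit.HodgeConjecture.HodgeConjecture.Cruxes.WeilTwelvefoldsSqrtMinus7.NegativeNotes.AmnesicDrefute

/-- VERBATIM statement of `stub_hyperbolicFourteenfolds` (S1, C⁺). -/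
def S1 : Prop :=

    ∀ (X : AbelianVariety ℂ) (ψ : X ⟶ X), X.dim = 14 → ψ ≫ ψ = -((7 : ℤ) • 𝟙 X) →
    ∀ h : complexBetti X.X 2, IsRationalClass h → h ∈ algebraicClasses X.X 1 →
      complexBetti.map ψ.hom.hom.hom 2 h = (7 : ℂ) • h →
      (∀ x : complexBetti X.X 1,
        (∀ y : complexBetti X.X 1, polarizationPairingOne X.X h 13 x y = 0) → x = 0) →
      IsHyperbolicWeilType X ψ 7 h →
    ∀ c : complexBetti X.X 14, IsRationalClass c → IsOfHodgeType 14 X.X 14 7 7 c →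
      c ∈ Module.End.eigenspace (complexBetti.map (𝟙 X + ψ).hom.hom.hom 14).hom
            ((1 + Complex.I * (Real.sqrt (7 : ℝ) : ℂ)) ^ 14) ⊔
          Module.End.eigenspace (complexBetti.map (𝟙 X + ψ).hom.hom.hom 14).hom
            ((1 - Complex.I * (Real.sqrt (7 : ℝ) : ℂ)) ^ 14) →
      c ∈ algebraicClasses X.X 7

/-- VERBATIM statement of `stub_hodgeTypeExterior` (S4, reshape r1: the two named facts of S6 as premises). -/
def S4 : Prop :=

    (∀ (m : ℕ) (Y : SchemeOver ℂ), nonempty_hodgeModel m Y) →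
    (∀ (E : Type) [NormedAddCommGroup E] [NormedSpace ℂ E] [FiniteDimensional ℂ E],
      Literature.NumberTheory.Transcendental.exists_deRhamIsoFamily (modelWithCornersSelf ℝ E)) →
    ∀ (A B : AbelianVariety ℂ) (a b : ℕ), A.dim = a → B.dim = b →
    ∀ (k l m : ℕ) (hklm : k + l = m) (p q p' q' : ℕ)
      (c : complexBetti A.X k) (w : complexBetti B.X l),
      IsOfHodgeType a A.X k p q c → IsOfHodgeType b B.X l p' q' w →
      IsOfHodgeType (a + b) (A.prod B).X m (p + p') (q + q')
        (cupProduct hklm (complexBetti.map (AbelianVariety.fst A B).hom.hom.hom k c)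
          (complexBetti.map (AbelianVariety.snd A B).hom.hom.hom l w))

/-- VERBATIM statement of `stub_descent` (S5). -/
def S5 : Prop :=

    (∀ (A B : AbelianVariety ℂ) (a b : ℕ), A.dim = a → B.dim = b →
      ∀ (k l m : ℕ) (hklm : k + l = m) (p q p' q' : ℕ)
        (c : complexBetti A.X k) (w : complexBetti B.X l),
        IsOfHodgeType a A.X k p q c → IsOfHodgeType b B.X l p' q' w →
        IsOfHodgeType (a + b) (A.prod B).X m (p + p') (q + q')
          (cupProduct hklm (complexBetti.map (AbelianVariety.fst A B).hom.hom.hom k c)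
            (complexBetti.map (AbelianVariety.snd A B).hom.hom.hom l w))) →
    ∀ (A : AbelianVariety ℂ) (φ : A ⟶ A) (B : AbelianVariety ℂ) (φB : B ⟶ B),
      A.dim = 12 → B.dim = 2 → φ ≫ φ = -((7 : ℤ) • 𝟙 A) → φB ≫ φB = -((7 : ℤ) • 𝟙 B) →
      (∃ bp bm η : complexBetti B.X 2,
        bp ∈ Module.End.eigenspace (complexBetti.map (𝟙 B + φB).hom.hom.hom 2).hom
              ((1 + Complex.I * (Real.sqrt (7 : ℝ) : ℂ)) ^ 2) ∧
        bm ∈ Module.End.eigenspace (complexBetti.map (𝟙 B + φB).hom.hom.hom 2).hom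
              ((1 - Complex.I * (Real.sqrt (7 : ℝ) : ℂ)) ^ 2) ∧
        IsRationalClass (bp + bm) ∧ IsOfHodgeType 2 B.X 2 1 1 (bp + bm) ∧
        η ∈ algebraicClasses B.X 1 ∧
        cupProduct (show 2 + 2 = 4 from rfl) bp η ≠ 0 ∧
        cupProduct (show 2 + 2 = 4 from rfl) bm η ≠ 0) →
      (∀ u : complexBetti (A.prod B).X 14, IsRationalClass u →
        IsOfHodgeType 14 (A.prod B).X 14 7 7 u →
        u ∈ Module.End.eigenspace (complexBetti.map (𝟙 (A.prod B) +
                AbelianVariety.prodLift (AbelianVariety.fst A B ≫ φ)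
                  (AbelianVariety.snd A B ≫ φB)).hom.hom.hom 14).hom
              ((1 + Complex.I * (Real.sqrt (7 : ℝ) : ℂ)) ^ 14) ⊔
            Module.End.eigenspace (complexBetti.map (𝟙 (A.prod B) +
                AbelianVariety.prodLift (AbelianVariety.fst A B ≫ φ)
                  (AbelianVariety.snd A B ≫ φB)).hom.hom.hom 14).hom
              ((1 - Complex.I * (Real.sqrt (7 : ℝ) : ℂ)) ^ 14) →
        u ∈ algebraicClasses (A.prod B).X 7) →
      ∀ c : complexBetti A.X 12, IsRationalClass c → IsOfHodgeType 12 A.X 12 6 6 c →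
        c ∈ Module.End.eigenspace (complexBetti.map (𝟙 A + φ).hom.hom.hom 12).hom
              ((1 + Complex.I * (Real.sqrt (7 : ℝ) : ℂ)) ^ 12) ⊔
            Module.End.eigenspace (complexBetti.map (𝟙 A + φ).hom.hom.hom 12).hom
              ((1 - Complex.I * (Real.sqrt (7 : ℝ) : ℂ)) ^ 12) →
        c ∈ algebraicClasses A.X 6

/-- VERBATIM statement of `stub_hodgeModelFacts` (S6). -/
def S6 : Prop :=

    (∀ (m : ℕ) (Y : SchemeOver ℂ), nonempty_hodgeModel m Y) ∧
    (∀ (E : Type) [NormedAddCommGroup E] [NormedSpace ℂ E] [FiniteDimensional ℂ E],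
      Literature.NumberTheory.Transcendental.exists_deRhamIsoFamily (modelWithCornersSelf ℝ E))

/-- **HC(14) ⟹ S1**, ignoring all hypotheses on `ψ`, `h`. [folklore] -/
theorem s1_of_hc14
    (HC14 : ∀ (X : AbelianVariety ℂ), X.dim = 14 → ∀ c : complexBetti X.X 14, IsRationalClass c →
      IsOfHodgeType 14 X.X 14 7 7 c → c ∈ algebraicClasses X.X 7) : S1 := by
  intro X ψ hX _ h _ _ _ _ _ c hr hH _
  exact HC14 X hX c hr hH

/-- **HC(12) ⟹ S5**, ignoring the partner, the descent pair and the 14-fold premise. [folklore] -/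
theorem s5_of_hc12
    (HC12 : ∀ (X : AbelianVariety ℂ), X.dim = 12 → ∀ c : complexBetti X.X 12, IsRationalClass c →
      IsOfHodgeType 12 X.X 12 6 6 c → c ∈ algebraicClasses X.X 6) : S5 := by
  intro _ A φ B φB hA _ _ _ _ _ c hr hH _
  exact HC12 A hA c hr hH

/-- **S6(a) alone gives the product Hodge model** (`A.prod B` is an abelian variety, hence smooth
projective of dimension `(A.prod B).dim`: `isSmoothProjective_holds`). [folklore] -/
theorem prodHodgeModel_of_s6 (h : S6) (A B : AbelianVariety ℂ) :
    Nonempty (HodgeModel (A.prod B).dim (A.prod B).X) :=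
  h.1 _ _ AbelianVariety.isSmoothProjective_holds

/-- **S4 forces a product Hodge model** (extraction at `c = w = 0`, `k = l = 0`; the two fact
premises of the reshaped S4 are passed through). [folklore] -/
theorem s4_forces_prodHodgeModel (h : S4) (hS6 : S6) (A B : AbelianVariety ℂ)
    (MA : HodgeModel A.dim A.X) (MB : HodgeModel B.dim B.X) :
    Nonempty (HodgeModel (A.dim + B.dim) (A.prod B).X) := by
  obtain ⟨M, -⟩ := h hS6.1 hS6.2 A B A.dim B.dim rfl rfl 0 0 0 rfl 0 0 0 0 0 0
    (IsOfHodgeType.zero MA 0 0 0) (IsOfHodgeType.zero MB 0 0 0)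
  exact ⟨M⟩

end Summit.HodgeConjecture.HodgeConjecture.Cruxes.WeilTwelvefoldsSqrtMinus7.NegativeNotes.AmnesicDrefute

end
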